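import Summits.Ventures.CertifiedManyBodySolver.Downfold.TperpSeamDimerDiagU
import Summits.Ventures.CertifiedManyBodySolver.Certificates.HubbardDimer_openBox2x1_sectorFloors_V6_V12_V16
import Literature.MathematicalPhysics.QuantumLattice.PeriodicLayeredLatticeTwoDimerDressedTransport
import HarnessLib

/-!
# The INTERLAYER seam, `U`-DRESSED on BOTH vertical bond classes: intra- AND inter-bilayer allowances are Hubbard
# DIMER rows `|t⊥|·A(V₁, n)`, `|t⊥'|·A(V₂, n)`, the in-plane floor read `V₁ t⊥ + V₂ t⊥` lower in `U`

Venture CertifiedManyBodySolver, stage S1 ↔ S2 seam (cell `pub/hubbard-downfold`'s grammar); ADAPTER by the S2 seat `hubbard-box-p3`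
(cell `pub/hubbard-fast`, 2026-08-28) for the Literature law `PeriodicLayeredLatticeTwoDimerDressedTransport`
(`le_infCellEnergyOn_bilayerHubbardTTPrime_twoDimer_unitRows`). Sequel of `TperpSeamDimerDiagU` (intra class dressed, inter class
kinematic `−mZ`): the S1 records print ONE interlayer row, so the seam knows the inter-bilayer amplitude only as `|t⊥'| ≤ |t⊥| ≤ mZ`;
here that untyped bond is dressed too (its dimer at `(|t⊥'|, V₂|t⊥'|)`, every sign of `t⊥'` by the open-box gauge symmetry
`groundEnergy_hubbardOpenBoxTT'_neg_t`), so its allowance drops from `mZ` to `mZ·A(V₂, n)`.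

* **`holdsOn_bilayerHubbardTTPrime_floor_of_anchorCell_twoDimer`** — box `B` with entries `eU, eS, eN, eZ` (`0 < eN.lo`, `eN.hi < 2`,
  `eZ.lo ≥ 0`), an S2 FLOOR `L` on a SOURCE CELL containing the anchor column `U_a ≥ 0` with `U_a + (V₁ + V₂)·eZ.hi ≤ eU.lo`
  (`V₁, V₂ ≥ 0`), unit dimer rows `(a₁, b₁)` at `V₁` and `(a₂, b₂)` at `V₂`, corner constants `c₁ ≤ z(a₁/2 + b₁n)` on
  `[eZ.lo, eZ.hi] × [eN.lo, eN.hi]` and `c₂ ≤ w(a₂/2 + b₂n)` on `[0, eZ.hi] × [eN.lo, eN.hi]`: on `B`, for every `|t⊥'| ≤ |p tperp/t|`,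
  `L + c₁ + c₂ ≤ inf_{period-2 periodic, filling p n} e(bilayer crystal at p)`.
* instance **`boxYBCO7M_M18_bilayer_floor_twoDimerV6`** (YBa₂Cu₃O₆.₉₂ #18; `U_a = 0` with box-p2's `aw_ybco7M_M18_word`, `V₁ = V₂ = 6`,
  `(V₁+V₂)·(9/20) = 5.4 ≤ 5.8`): **`−1.5601315986 − 0.1691096 − 0.1691096 ≤ inf …`** = `−1.8983508`, against `−2.160336`
  (`TperpSeamDimerDiagU`, inter class kinematic) and `−2.4601316` (kinematic seam `boxYBCO7M_M18_bilayerEnergyWord`): **+0.562 t**.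

Everything is PROVED; no definition, no number of record. HONEST FRAMING: energy floors of the period-2 stacked one-band crystal over its
period-2 periodic states; inputs are S2 words and kernel dimer tables BY NAME; a downfolded box is a modelling claim; no phase sentence.
-/

noncomputable section

namespace Summit.Ventures.CertifiedManyBodySolver.Downfold

open NonemptyInterval Literature.MathematicalPhysics.QuantumLattice
  Literature.MathematicalPhysics.QuantumLattice.ThermodynamicLimit Literature.Probability.LatticeModels
open Summit.Ventures.CertifiedManyBodySolver.Certificates

/-- **THE TWO-DIMER BILAYER FLOOR SEAM** (both vertical bond classes dressed; see the module docstring for the data).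
[cite: Anderson1951, eq. (2)] -/
theorem holdsOn_bilayerHubbardTTPrime_floor_of_anchorCell_twoDimer {B : OneBandBox} {eU eS eN eZ : Entry}
    (hU : B .UOverT = some eU) (hS : B .tpOverT = some eS) (hN : B .filling = some eN)
    (hZ : B .tperpOverT = some eZ) (hN0 : 0 < eN.encl.fst) (hN2 : eN.encl.snd < 2) (hZ0 : 0 ≤ eZ.encl.fst)
    {Ulo' slo' nlo' Uhi' shi' nhi' L : ℝ}
    (hL : ∀ θ ∈ Set.Icc (![Ulo', slo', nlo'] : Fin 3 → ℝ) ![Uhi', shi', nhi'],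
      L ≤ energyDensityTT' 1 (θ 1) (θ 0) (θ 2))
    {Ua V₁ V₂ : ℝ} (hUa0 : 0 ≤ Ua) (hUa : Ulo' ≤ Ua ∧ Ua ≤ Uhi')
    (hS' : slo' ≤ ((eS.encl.fst : ℚ) : ℝ) ∧ ((eS.encl.snd : ℚ) : ℝ) ≤ shi')
    (hN' : nlo' ≤ ((eN.encl.fst : ℚ) : ℝ) ∧ ((eN.encl.snd : ℚ) : ℝ) ≤ nhi') (hV₁ : 0 ≤ V₁) (hV₂ : 0 ≤ V₂)
    (hUaU : Ua + (V₁ + V₂) * ((eZ.encl.snd : ℚ) : ℝ) ≤ ((eU.encl.fst : ℚ) : ℝ))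
    {a₁ b₁ a₂ b₂ : ℝ} (hrow₁ : ∀ k : ℕ, k ≤ 4 → a₁ + b₁ * k ≤ groundEnergy (hubbardOpenBoxTT' 2 1 1 0 V₁) k)
    (hrow₂ : ∀ k : ℕ, k ≤ 4 → a₂ + b₂ * k ≤ groundEnergy (hubbardOpenBoxTT' 2 1 1 0 V₂) k)
    {c₁ c₂ : ℝ}
    (hc₁ : ∀ z n : ℝ, ((eZ.encl.fst : ℚ) : ℝ) ≤ z ∧ z ≤ ((eZ.encl.snd : ℚ) : ℝ) →
      ((eN.encl.fst : ℚ) : ℝ) ≤ n ∧ n ≤ ((eN.encl.snd : ℚ) : ℝ) → c₁ ≤ z * (2⁻¹ * (a₁ + 2 * b₁ * n)))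
    (hc₂ : ∀ w n : ℝ, 0 ≤ w ∧ w ≤ ((eZ.encl.snd : ℚ) : ℝ) →
      ((eN.encl.fst : ℚ) : ℝ) ≤ n ∧ n ≤ ((eN.encl.snd : ℚ) : ℝ) → c₂ ≤ w * (2⁻¹ * (a₂ + 2 * b₂ * n))) :
    HoldsOn (fun p : OneBandCoord → ℝ => ∀ tperp' : ℝ, |tperp'| ≤ |p .tperpOverT| →
      L + c₁ + c₂ ≤
        infCellEnergyOn (periodicStatesAt (stackPeriods 2 1) (p .filling))
          (periodicLayeredHubbardTTPrimeViews 1 1 (p .tpOverT) (p .UOverT)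
            (fun _ : Fin 1 => (unitVec (0 : Fin 3) : Site 3)) fun j _ => ![p .tperpOverT, tperp'] j) 1) B := by
  intro p hp tperp' htp
  have hu := mem_ratCast_iff.1 (hp _ _ hU)
  have hs := mem_ratCast_iff.1 (hp _ _ hS)
  have hn := mem_ratCast_iff.1 (hp _ _ hN)
  have hz := mem_ratCast_iff.1 (hp _ _ hZ)
  have hN0' : (0 : ℝ) < ((eN.encl.fst : ℚ) : ℝ) := by exact_mod_cast hN0
  have hN2' : ((eN.encl.snd : ℚ) : ℝ) < 2 := by exact_mod_cast hN2
  have hZ0' : (0 : ℝ) ≤ ((eZ.encl.fst : ℚ) : ℝ) := by exact_mod_cast hZ0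
  have hn0 : 0 < p .filling := lt_of_lt_of_le hN0' hn.1
  have hn2 : p .filling < 2 := lt_of_le_of_lt hn.2 hN2'
  have hz0 : 0 ≤ p .tperpOverT := hZ0'.trans hz.1
  have habs : |p .tperpOverT| = p .tperpOverT := abs_of_nonneg hz0
  have hw : 0 ≤ |tperp'| ∧ |tperp'| ≤ ((eZ.encl.snd : ℚ) : ℝ) := ⟨abs_nonneg _, htp.trans (habs.le.trans hz.2)⟩
  have hV₁z : V₁ * p .tperpOverT ≤ V₁ * ((eZ.encl.snd : ℚ) : ℝ) := mul_le_mul_of_nonneg_left hz.2 hV₁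
  have hV₂w : V₂ * |tperp'| ≤ V₂ * ((eZ.encl.snd : ℚ) : ℝ) := mul_le_mul_of_nonneg_left hw.2 hV₂
  have hUW : Ua ≤ p .UOverT - V₁ * p .tperpOverT - V₂ * |tperp'| := by nlinarith [hu.1]
  have hUW0 : 0 ≤ p .UOverT - V₁ * |p .tperpOverT| - V₂ * |tperp'| := by
    rw [habs]; exact hUa0.trans hUW
  -- the law at the member
  have hlaw := le_infCellEnergyOn_bilayerHubbardTTPrime_twoDimer_unitRows 1 (p .tpOverT) (p .tperpOverT) tperp' hUW0 hn0 hn2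
    hrow₁ hrow₂
  -- the in-plane floor at the anchor column
  have hmono := energyDensityTT'_mono_U 1 (p .tpOverT) hn0.le hn2 hUa0 hUW
  have hmem : (![Ua, p .tpOverT, p .filling] : Fin 3 → ℝ) ∈
      Set.Icc (![Ulo', slo', nlo'] : Fin 3 → ℝ) ![Uhi', shi', nhi'] :=
    mem_Icc_vec3_iff.2 ⟨⟨hUa.1, hUa.2⟩, ⟨hS'.1.trans hs.1, hs.2.trans hS'.2⟩, ⟨hN'.1.trans hn.1, hn.2.trans hN'.2⟩⟩
  have hθ := hL _ hmem
  have e0 : (![Ua, p .tpOverT, p .filling] : Fin 3 → ℝ) 0 = Ua := rfl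
  have e1 : (![Ua, p .tpOverT, p .filling] : Fin 3 → ℝ) 1 = p .tpOverT := rfl
  have e2 : (![Ua, p .tpOverT, p .filling] : Fin 3 → ℝ) 2 = p .filling := rfl
  rw [e0, e1, e2] at hθ
  -- the two dressed terms
  have hcc₁ := hc₁ (p .tperpOverT) (p .filling) hz hn
  have hcc₂ := hc₂ |tperp'| (p .filling) hw hn
  rw [habs] at hlaw
  linarith

/-! ### Instance: YBa₂Cu₃O₆.₉₂ (`boxYBCO7M_M18`), both classes dressed at `V₁ = V₂ = 6` -/

/-- **The `V = 6` dimer chord through `k = 1, 2` as unit rows on the open `2 × 1` cluster**: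
`−1.3945485 + 0.3944483·k ≤ E₀(h_{2×1}(1, 0, 6), k)`, `k ≤ 4` (kernel table `dimer_V6_table` + `dimer_V6_line_k12`).
[cite: KullEtAl2024, §5.3] -/
theorem dimer_V6_rows_k12 : ∀ k : ℕ, k ≤ 4 →
    (((-2789097 : ℚ) / 2000000 : ℚ) : ℝ) + (((3944483 : ℚ) / 10000000 : ℚ) : ℝ) * k ≤
      groundEnergy (hubbardOpenBoxTT' 2 1 1 0 (6 : ℝ)) k := by
  intro k hk
  have h1 := dimer_V6_line_k12 k hk
  have h2 := dimer_V6_table k hk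
  have h1' : (((-2789097 : ℚ) / 2000000 : ℚ) : ℝ) + (((3944483 : ℚ) / 10000000 : ℚ) : ℝ) * k ≤ ((dimer_V6_sigma k : ℚ) : ℝ) := by
    exact_mod_cast h1
  exact h1'.trans h2

/-- **YBa₂Cu₃O₆.₉₂ bilayer floor, BOTH vertical bond classes `U`-DRESSED (`V₁ = V₂ = 6`), HYPOTHESIS-FREE.** On `boxYBCO7M_M18`,
with box-p2's `U`-uniform floor `aw_ybco7M_M18_word` anchored at `U_a = 0` (`(V₁+V₂)·(9/20) = 5.4 ≤ 5.8`) and the `V = 6` dimer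
chord on both classes: for every member and every `|t⊥'| ≤ |p tperp/t|`,
`−1.5601315986 − 0.1691096 − 0.1691096 ≤ inf_{period-2 periodic, filling p n} e(bilayer t–t' crystal)` (`= −1.8983508`; kinematic seam
`−2.4601316`, intra-only dressed `−2.160336`). [cite: Anderson1951, eq. (2)] -/
theorem boxYBCO7M_M18_bilayer_floor_twoDimerV6 :
    HoldsOn (fun p : OneBandCoord → ℝ => ∀ tperp' : ℝ, |tperp'| ≤ |p .tperpOverT| →
      (-1.5601315986 : ℝ) + (-0.1691096 : ℝ) + (-0.1691096 : ℝ) ≤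
        infCellEnergyOn (periodicStatesAt (stackPeriods 2 1) (p .filling))
          (periodicLayeredHubbardTTPrimeViews 1 1 (p .tpOverT) (p .UOverT)
            (fun _ : Fin 1 => (unitVec (0 : Fin 3) : Site 3)) fun j _ => ![p .tperpOverT, tperp'] j) 1) boxYBCO7M_M18 := by
  have hLw : ∀ θ ∈ Set.Icc (![0, -3/10, 163/200] : Fin 3 → ℝ) ![20, -19/100, 43/50],
      (-1.5601315986 : ℝ) ≤ energyDensityTT' 1 (θ 1) (θ 0) (θ 2) := fun θ hθ => (aw_ybco7M_M18_word θ hθ).1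
  exact holdsOn_bilayerHubbardTTPrime_floor_of_anchorCell_twoDimer (B := boxYBCO7M_M18) (eU := yBCO7M_M18_U)
    (eS := yBCO7M_M18_tp) (eN := yBCO7M_M18_n) (eZ := yBCO7M_M18_tperp) rfl rfl rfl rfl
    (by rw [yBCO7M_M18_n, Entry.encl_ofEnds_fst]; norm_num)
    (by rw [yBCO7M_M18_n, Entry.encl_ofEnds_snd]; norm_num)
    (by rw [yBCO7M_M18_tperp, Entry.encl_ofEnds_fst]; norm_num)
    hLw (Ua := 0) (V₁ := 6) (V₂ := 6) le_rfl ⟨le_rfl, by norm_num⟩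
    (by rw [yBCO7M_M18_tp, Entry.encl_ofEnds_fst, Entry.encl_ofEnds_snd]; constructor <;> norm_num)
    (by rw [yBCO7M_M18_n, Entry.encl_ofEnds_fst, Entry.encl_ofEnds_snd]; constructor <;> norm_num)
    (by norm_num) (by norm_num)
    (by rw [yBCO7M_M18_tperp, Entry.encl_ofEnds_snd, yBCO7M_M18_U, Entry.encl_ofEnds_fst]; norm_num)
    dimer_V6_rows_k12 dimer_V6_rows_k12 (c₁ := (-0.1691096 : ℝ)) (c₂ := (-0.1691096 : ℝ))
    (by
      rw [yBCO7M_M18_tperp, Entry.encl_ofEnds_fst, Entry.encl_ofEnds_snd, yBCO7M_M18_n, Entry.encl_ofEnds_fst,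
        Entry.encl_ofEnds_snd]
      intro z n hz hn
      push_cast at hz hn ⊢
      exact mul_half_affine_ge_of_corners (by norm_num) (by norm_num) (by norm_num) (by norm_num) (by norm_num) hz hn)
    (by
      rw [yBCO7M_M18_tperp, Entry.encl_ofEnds_snd, yBCO7M_M18_n, Entry.encl_ofEnds_fst, Entry.encl_ofEnds_snd]
      intro w n hw hn
      push_cast at hw hn ⊢
      exact mul_half_affine_ge_of_corners le_rfl (by norm_num) (by norm_num) (by norm_num) (by norm_num) hw hn)

/-- **Decimal form**: `−1.898351 ≤ inf_{period-2 periodic, filling p n} e(bilayer crystal)` on `boxYBCO7M_M18` for every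
`|t⊥'| ≤ |p tperp/t|` (intra-only dressed `−2.160336`; kinematic seam `−2.4601316`). [cite: Anderson1951, eq. (2)] -/
theorem boxYBCO7M_M18_bilayer_floor_twoDimerV6_decimal :
    HoldsOn (fun p : OneBandCoord → ℝ => ∀ tperp' : ℝ, |tperp'| ≤ |p .tperpOverT| →
      (-1.898351 : ℝ) ≤
        infCellEnergyOn (periodicStatesAt (stackPeriods 2 1) (p .filling))
          (periodicLayeredHubbardTTPrimeViews 1 1 (p .tpOverT) (p .UOverT)
            (fun _ : Fin 1 => (unitVec (0 : Fin 3) : Site 3)) fun j _ => ![p .tperpOverT, tperp'] j) 1) boxYBCO7M_M18 := by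
  intro p hp tperp' htp
  have h := boxYBCO7M_M18_bilayer_floor_twoDimerV6 p hp tperp' htp
  norm_num at h ⊢
  linarith

/-! ### Appendix (g14, same session): the window form and the closed two-sided YBa₂Cu₃O₆.₉₂ bilayer word -/

/-- **THE TWO-DIMER BILAYER WINDOW SEAM**: the floor of `holdsOn_bilayerHubbardTTPrime_floor_of_anchorCell_twoDimer` together with the
box's OWN S2 cap `R` on its delivered cell (`eU.lo ≥ 0`; the cap of a stacked crystal is the in-plane cap). On `B`, for every
`|t⊥'| ≤ |p tperp/t|`: `L + c₁ + c₂ ≤ inf … ≤ R`. [cite: BratteliKishimotoRobinson1978, Thm. 2 (condition 2)] -/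
theorem holdsOn_bilayerHubbardTTPrime_window_of_anchorCell_twoDimer {B : OneBandBox} {eU eS eN eZ : Entry}
    (hU : B .UOverT = some eU) (hS : B .tpOverT = some eS) (hN : B .filling = some eN)
    (hZ : B .tperpOverT = some eZ) (hU0 : 0 ≤ eU.encl.fst) (hN0 : 0 < eN.encl.fst) (hN2 : eN.encl.snd < 2)
    (hZ0 : 0 ≤ eZ.encl.fst)
    {Ulo' slo' nlo' Uhi' shi' nhi' L : ℝ}
    (hL : ∀ θ ∈ Set.Icc (![Ulo', slo', nlo'] : Fin 3 → ℝ) ![Uhi', shi', nhi'],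
      L ≤ energyDensityTT' 1 (θ 1) (θ 0) (θ 2))
    {R : ℝ} (hR : ∀ θ ∈ Set.Icc (s2Lo eU eS eN) (s2Hi eU eS eN), energyDensityTT' 1 (θ 1) (θ 0) (θ 2) ≤ R)
    {Ua V₁ V₂ : ℝ} (hUa0 : 0 ≤ Ua) (hUa : Ulo' ≤ Ua ∧ Ua ≤ Uhi')
    (hS' : slo' ≤ ((eS.encl.fst : ℚ) : ℝ) ∧ ((eS.encl.snd : ℚ) : ℝ) ≤ shi')
    (hN' : nlo' ≤ ((eN.encl.fst : ℚ) : ℝ) ∧ ((eN.encl.snd : ℚ) : ℝ) ≤ nhi') (hV₁ : 0 ≤ V₁) (hV₂ : 0 ≤ V₂)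
    (hUaU : Ua + (V₁ + V₂) * ((eZ.encl.snd : ℚ) : ℝ) ≤ ((eU.encl.fst : ℚ) : ℝ))
    {a₁ b₁ a₂ b₂ : ℝ} (hrow₁ : ∀ k : ℕ, k ≤ 4 → a₁ + b₁ * k ≤ groundEnergy (hubbardOpenBoxTT' 2 1 1 0 V₁) k)
    (hrow₂ : ∀ k : ℕ, k ≤ 4 → a₂ + b₂ * k ≤ groundEnergy (hubbardOpenBoxTT' 2 1 1 0 V₂) k)
    {c₁ c₂ : ℝ}
    (hc₁ : ∀ z n : ℝ, ((eZ.encl.fst : ℚ) : ℝ) ≤ z ∧ z ≤ ((eZ.encl.snd : ℚ) : ℝ) →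
      ((eN.encl.fst : ℚ) : ℝ) ≤ n ∧ n ≤ ((eN.encl.snd : ℚ) : ℝ) → c₁ ≤ z * (2⁻¹ * (a₁ + 2 * b₁ * n)))
    (hc₂ : ∀ w n : ℝ, 0 ≤ w ∧ w ≤ ((eZ.encl.snd : ℚ) : ℝ) →
      ((eN.encl.fst : ℚ) : ℝ) ≤ n ∧ n ≤ ((eN.encl.snd : ℚ) : ℝ) → c₂ ≤ w * (2⁻¹ * (a₂ + 2 * b₂ * n))) :
    HoldsOn (fun p : OneBandCoord → ℝ => ∀ tperp' : ℝ, |tperp'| ≤ |p .tperpOverT| →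
      L + c₁ + c₂ ≤
          infCellEnergyOn (periodicStatesAt (stackPeriods 2 1) (p .filling))
            (periodicLayeredHubbardTTPrimeViews 1 1 (p .tpOverT) (p .UOverT)
              (fun _ : Fin 1 => (unitVec (0 : Fin 3) : Site 3)) fun j _ => ![p .tperpOverT, tperp'] j) 1 ∧
        infCellEnergyOn (periodicStatesAt (stackPeriods 2 1) (p .filling))
            (periodicLayeredHubbardTTPrimeViews 1 1 (p .tpOverT) (p .UOverT)
              (fun _ : Fin 1 => (unitVec (0 : Fin 3) : Site 3)) fun j _ => ![p .tperpOverT, tperp'] j) 1 ≤ R) B := by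
  intro p hp tperp' htp
  refine ⟨holdsOn_bilayerHubbardTTPrime_floor_of_anchorCell_twoDimer hU hS hN hZ hN0 hN2 hZ0 hL hUa0 hUa hS' hN' hV₁ hV₂
    hUaU hrow₁ hrow₂ hc₁ hc₂ p hp tperp' htp, ?_⟩
  obtain ⟨hu0, hn0, hn2⟩ := mem_sideConditions hU hN hU0 hN0 hN2 hp
  have hθ := s2Coords_mem_Icc hU hS hN hp
  have hRp := hR _ hθ
  have h1 : s2Coords p 1 = p .tpOverT := rfl
  have h0 : s2Coords p 0 = p .UOverT := rfl
  have h2 : s2Coords p 2 = p .filling := rfl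
  rw [h1, h0, h2] at hRp
  exact (infCellEnergyOn_bilayerHubbardTTPrime_mem_Icc 1 (p .tpOverT) hu0 hn0 hn2 (p .tperpOverT) tperp').2.trans hRp

/-- **THE CLOSED TWO-SIDED YBa₂Cu₃O₆.₉₂ BILAYER WORD, HYPOTHESIS-FREE**: on `boxYBCO7M_M18`, for every member and every
`|t⊥'| ≤ |p tperp/t|`, the variational cell energy of the period-2 stacked `t–t'` crystal over its period-2 periodic states at cell filling
`p n` lies in **`[−1.898351, −0.4945932713]`** (floor: `boxYBCO7M_M18_bilayer_floor_twoDimerV6`; cap: box-p2's `aw_ybco7M_M18_word`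
through the in-plane cap) — replacing `boxYBCO7M_M18_bilayer_word_sandwich`'s `[−2.4601316, −0.4945932713]`: width `1.966 → 1.404`.
[cite: BratteliKishimotoRobinson1978, Thm. 2 (condition 2)] -/
theorem boxYBCO7M_M18_bilayer_window_twoDimerV6 :
    HoldsOn (fun p : OneBandCoord → ℝ => ∀ tperp' : ℝ, |tperp'| ≤ |p .tperpOverT| →
      (-1.898351 : ℝ) ≤
          infCellEnergyOn (periodicStatesAt (stackPeriods 2 1) (p .filling))
            (periodicLayeredHubbardTTPrimeViews 1 1 (p .tpOverT) (p .UOverT)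
              (fun _ : Fin 1 => (unitVec (0 : Fin 3) : Site 3)) fun j _ => ![p .tperpOverT, tperp'] j) 1 ∧
        infCellEnergyOn (periodicStatesAt (stackPeriods 2 1) (p .filling))
            (periodicLayeredHubbardTTPrimeViews 1 1 (p .tpOverT) (p .UOverT)
              (fun _ : Fin 1 => (unitVec (0 : Fin 3) : Site 3)) fun j _ => ![p .tperpOverT, tperp'] j) 1 ≤
          (-0.4945932713 : ℝ)) boxYBCO7M_M18 := by
  intro p hp tperp' htp
  refine ⟨boxYBCO7M_M18_bilayer_floor_twoDimerV6_decimal p hp tperp' htp, ?_⟩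
  have hcap : ∀ θ ∈ Set.Icc (s2Lo yBCO7M_M18_U yBCO7M_M18_tp yBCO7M_M18_n) (s2Hi yBCO7M_M18_U yBCO7M_M18_tp yBCO7M_M18_n),
      energyDensityTT' 1 (θ 1) (θ 0) (θ 2) ≤ (-0.4945932713 : ℝ) := by
    rw [yBCO7M_M18_s2Lo, yBCO7M_M18_s2Hi]
    intro θ hθ
    obtain ⟨⟨hu₁, hu₂⟩, ⟨hs₁, hs₂⟩, ⟨hm₁, hm₂⟩⟩ := mem_Icc_vec3_iff.1 hθ
    exact (aw_ybco7M_M18_word θ (mem_Icc_vec3_iff.2 ⟨⟨by linarith, by linarith⟩, ⟨hs₁, hs₂⟩, ⟨hm₁, hm₂⟩⟩)).2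
  obtain ⟨hu0, hn0, hn2⟩ := mem_sideConditions (B := boxYBCO7M_M18) (eU := yBCO7M_M18_U) (eN := yBCO7M_M18_n) rfl rfl
    (by rw [yBCO7M_M18_U, Entry.encl_ofEnds_fst]; norm_num) (by rw [yBCO7M_M18_n, Entry.encl_ofEnds_fst]; norm_num)
    (by rw [yBCO7M_M18_n, Entry.encl_ofEnds_snd]; norm_num) hp
  have hθ := s2Coords_mem_Icc (B := boxYBCO7M_M18) (eU := yBCO7M_M18_U) (eS := yBCO7M_M18_tp) (eN := yBCO7M_M18_n)
    rfl rfl rfl hp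
  have hRp := hcap _ hθ
  have h1 : s2Coords p 1 = p .tpOverT := rfl
  have h0 : s2Coords p 0 = p .UOverT := rfl
  have h2 : s2Coords p 2 = p .filling := rfl
  rw [h1, h0, h2] at hRp
  exact (infCellEnergyOn_bilayerHubbardTTPrime_mem_Icc 1 (p .tpOverT) hu0 hn0 hn2 (p .tperpOverT) tperp').2.trans hRp

end Summit.Ventures.CertifiedManyBodySolver.Downfold

end
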